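import Literature.NumberTheory.Automorphic.WhittakerBesselGL2

/-!
# Torsplit — first lemma of the crux idea `torsplit` (crux stmt-BirchSwinnertonDyer-20502)

The algebraic half of the TORUS LEMMA: the Whittaker function of a unipotent-averaged
("Gauss-twisted") vector on the torus `d(a,1)` is the character sum `Σ cᵢ ψ(a xᵢ)` times the
Whittaker function of the original vector.  With `cᵢ = χ(-i)`, `xᵢ = i ϖ^{-t}` (i mod ϖ^t) the sum is a
Gauss sum supported on `v(a) = 0` — the support statement that makes CLW's split-place local
triple-product constant independent of the type (PS / supercuspidal / St ⊗ χ) of `π_v`.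
-/

namespace Summit.BirchSwinnertonDyer.BirchSwinnertonDyer.Cruxes.TwistPairGreenbergProductDivisibilitySplit.Torsplit

open Literature.NumberTheory.Automorphic

variable {R : Type*} [CommRing R] {V : Type*} [AddCommGroup V] [Module ℂ V]

/-- **Torus formula for a Gauss-twisted vector.** For a Whittaker functional `Λ` of `(π, V)` w.r.t. `ψ`,
`W_{Σ cᵢ π(n(xᵢ)) v}(d(a,1)) = (Σ cᵢ ψ(a xᵢ)) · W_v(d(a,1))`. [folklore; Bushnell–Henniart §36] -/
theorem whittakerModel_sum_unipotent_diagGL2 (π : Representation ℂ (GL (Fin 2) R) V)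
    (ψ : AddChar R Circle) (Λ : Module.Dual ℂ V) (hΛ : Λ ∈ whittakerFunctionals π ψ) (v : V)
    {ι : Type*} (s : Finset ι) (c : ι → ℂ) (x : ι → R) (a : Rˣ) :
    whittakerModel π Λ
        (∑ i ∈ s, c i • π ((unipotentGL2 (x i) : ↥(upperUnitriangular (Fin 2) R)) : GL (Fin 2) R) v)
        (diagGL2 a 1)
      = (∑ i ∈ s, c i * whittakerCharFun ψ (unipotentGL2 ((a : R) * x i)))
          * whittakerModel π Λ v (diagGL2 a 1) := by
  classical
  simp only [map_sum, map_smul, smul_eq_mul, whittakerModel_apply,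
    Finset.sum_mul]
  refine Finset.sum_congr rfl fun i _ => ?_
  have h1 : π (diagGL2 a 1) (π ((unipotentGL2 (x i) : ↥(upperUnitriangular (Fin 2) R)) : GL (Fin 2) R) v)
      = π ((unipotentGL2 ((a : R) * x i) : ↥(upperUnitriangular (Fin 2) R)) : GL (Fin 2) R)
          (π (diagGL2 a 1) v) := by
    rw [← Module.End.mul_apply, ← map_mul, diagGL2_mul_unipotentGL2, map_mul, Module.End.mul_apply]
  rw [h1, (mem_whittakerFunctionals_iff Λ).1 hΛ, mul_assoc]

/-- The TORUS LEMMA as a route-level proposition (informal content typed minimally): the torus values of a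
Gauss-twisted vector are `ψ`-character sums times the torus values of the vector — the `Prop` the crux idea
`torsplit` names as its first checkable statement (it is the theorem above, universally quantified). -/
def TorusTwistFormula : Prop :=
  ∀ (R : Type) [CommRing R] (V : Type) [AddCommGroup V] [Module ℂ V]
    (π : Representation ℂ (GL (Fin 2) R) V) (ψ : AddChar R Circle) (Λ : Module.Dual ℂ V),
    Λ ∈ whittakerFunctionals π ψ → ∀ (v : V) (n : ℕ) (c : Fin n → ℂ) (x : Fin n → R) (a : Rˣ),
      whittakerModel π Λ
          (∑ i, c i • π ((unipotentGL2 (x i) : ↥(upperUnitriangular (Fin 2) R)) : GL (Fin 2) R) v)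
          (diagGL2 a 1)
        = (∑ i, c i * whittakerCharFun ψ (unipotentGL2 ((a : R) * x i)))
            * whittakerModel π Λ v (diagGL2 a 1)

theorem torusTwistFormula_holds : TorusTwistFormula := by
  intro R _ V _ _ π ψ Λ hΛ v n c x a
  exact whittakerModel_sum_unipotent_diagGL2 π ψ Λ hΛ v Finset.univ c x a

end Summit.BirchSwinnertonDyer.BirchSwinnertonDyer.Cruxes.TwistPairGreenbergProductDivisibilitySplit.Torsplit
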